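import Literature.MathematicalPhysics.QuantumFieldTheory.Balaban1983to89.B1Ineq224RegularRegion
import Literature.MathematicalPhysics.QuantumFieldTheory.Balaban1983to89.B1Ineq225RegularBox
import Literature.MathematicalPhysics.QuantumFieldTheory.Balaban1983to89.B1TorusSubBoxHolderInput

/-!
# `Balaban1983to89.B1TorusBoxHolderLetters` — THE HÖLDER LETTER «‖h_{ω₀}G_k(□_{ω₀},A_{ω₀})h_{ω₀}‖_{(1,α),∞}» OF [Balaban1983RegularityDecay]
# (2.20) AT **EVERY** LABEL OF A CELL-PRODUCT BOX OF LARGE BLOCKS OF THE (Higgs)₂,₃ TORUS, under [Balaban1982Higgs1] (2.23) on the box —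
# the per-label (1,α)-input of Prop. 2.1 (2.24) «without any restrictions on the points x, x′» (p. 611 l.1–2)

statement-level skeleton of published theorems with citation tags; proofs where landed; nothing here is a claim about the Yang–Mills mass gap

PDF held: `paper:balaban1983-cmp89-regularity-decay` pp. 573, 575, 577–579 [PDF 3, 5, 7–9]; `paper:balaban1982-cmp85-higgs23-i` pp. 610–611
[PDF 8–9] (`p0008.txt`, `p0009.txt`, re-read by this seat).

CITATION HEADER (lean-in-tree rule).  T. Bałaban, *Regularity and decay of lattice Green's functions*, Commun. Math. Phys. **89** (1983)
571–597 [Balaban1983RegularityDecay] (Theorem (1.9) p. 573; §2 p. 575 cubes, `h_j`, «Ã_j = A» at boundary cubes; (2.13)–(2.14) p. 577;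
(2.18)–(2.20) p. 578; p. 579 L25–28) and T. Bałaban, *(Higgs)₂,₃ quantum fields in a finite volume. I*, Commun. Math. Phys. **85** (1982)
603–626 [Balaban1982Higgs1] (Prop. 2.1 (2.23)–(2.24) p. 610, p. 611 l.1–2).  Cell `lit-balaban` (HOME `run/shared/lean/pub/lit-balaban/`),
Phase-2 proof seat **p35** gen 21 (unit `lit-balaban-p35`); SKELETON rows **B1.Prop2.1** / **B1.Eq2.24** (parallelepiped clause, Hölder member:
the letters) and **B4.Thm@573** / **B4.Eq2.18** ((2.20) Hölder factor at boundary pieces, carrier instance).  USED BY NAME, never restated: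
gen 10's `B1TorusCubeHolderProbe.{norm_probe_hsmul_le, abs_hTor_chain_sub_le, abs_sderiv_hTor_sub_le}`, gen 12's
`B1Ineq224RegularRegion.cube_input_holder_reg_on` and `B1Ineq225DerivRegularRegion.cube_deriv_sup` (interior windows), gen 15's
`B1Ineq225RegularBox.{cellBox, piece_cellBox_eq_boxT, piece_cellBox_empty, jB, MbB, jlB, hTor_toT_jB, hTor_smul_supported_piece,
abs_acT_sub_le_of_reg_on_boxT, …}` and `B1TorusSubBoxOp.subbox_inputs` (boundary pieces, sup letters), this seat's gen-21
`B1TorusSubBoxHolderInput.subbox_input_holder` (boundary pieces, the Hölder input with no collar), gen 10's `B1TorusChainTransport`.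

WHAT IS PRINTED.  [B4] p. 578 [PDF 8]: «If any of the points x, x′ belongs to supp h_j, then both belong to □_j and in the representation (2.13)
for each term we have that either both points belong to □_{ω₁}, or none. … We estimate the first sum using Lemma 2.2 by
Σ′ ‖h_{ω₀}G_k(□_{ω₀},A_{ω₀})h_{ω₀}‖_{(1,α),∞} Π_i ‖K_{ω_i}G_k(□_{ω_i},A_{ω_i})h_{ω_i}‖_{∞,∞} ‖f‖_∞ (2.20)»; p. 579 [PDF 9] L25–28, verbatim:
«Finally let us notice that if Ω is a rectangular parallelepiped, then all □_j in the representation (2.13) are cubes and we can apply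
Lemma 2.2 to all operators in it, so the restriction dist({x, x′}, Ωᶜ) ≧ R₀ is unnecessary.»; p. 575 [PDF 5] L22–24, verbatim: «where the
configurations Ã_j are constructed in the following way: if □_j intersects the boundary of Ω, then Ã_j = A; if □_j is an interior cube of
Ω, then we take Ã_j as equal to A on the cube {x : |x − Mj| ≦ (3/4)M}, and changing regularly to a constant function in a neighbourhood of
a boundary of □_j.»  [B1] p. 611 [PDF 9] l.1–2, verbatim: «For some simple sets Ω, e.g. for rectangular parallelepipeds, the inequalities
hold without any restrictions on the points x, x′.»

WHAT THIS MODULE PROVES (theorems only; no `def`, no `Prop` fact, no `sorry`; axioms standard).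
* §1 **`norm_probe_hsmul_le_on`** — gen 10's (1,α)-quotient of one letter `h_ju` for a field `u` whose inputs are known AT THE FIELD `A`
  ITSELF on the bonds of a set `R` (the boundary piece «Ã_j = A»): same Leibniz bookkeeping, no change of field.
* §2 **`box_letters_holder`** — AT EVERY LABEL `j` of a cell-product box `Ω = cellBox S` under (2.23) on `Ω`: for sites `x ≠ x′` with
  `x, x+εe_μ, x′, x′+εe_μ ∈ Ω`, `|x − x′| ≤ L^K`, a nearest-neighbour chain `Γ ⊂ Ω` with `|Γ| ≤ d|x − x′|`, every `Ω`-supported `ψ`: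
  `‖U(A(Γ))(D^ε_A a_jψ)(⟨x′,μ⟩) − (D^ε_A a_jψ)(⟨x,μ⟩)‖ ≤ C_T(|x − x′|/L^K)^α(L^Kε)‖ψ‖_∞`, `a_jψ = h_jG_j(h_jψ)` — interior windows by gen 10/12
  (`norm_probe_hsmul_le` fed by `cube_deriv_sup`, `cube_input_holder_reg_on`), boundary pieces by §1 fed by `subbox_inputs` and
  `subbox_input_holder` on the sub-box `boxT` of the neighbouring chart (`piece_cellBox_eq_boxT`), empty pieces trivially.
HONEST SCOPE.  (i) `Ω` a cell-product of large blocks (`M = L^KK₀`, `K₀ ∣ M_P`, `3M ≤ |T_ε|_μ`, `K₀ ≥ 8d + 24` for the contour room); (ii) the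
chain `Γ` is assumed inside `Ω` (for a box and `x, x′ ∈ Ω` a shortest staircase contour is); (iii) constants existential, explicit in the
proofs.  The consumer is `B1Ineq224RegularBox` (Prop. 2.1 (2.24) on boxes, no `R₀`).  Unit `lit-balaban-p35` gen 21
(literature-prover-lit-balaban-p35-g21-0).
-/

open scoped BigOperators Matrix

noncomputable section

namespace Literature.MathematicalPhysics.QuantumFieldTheory.Balaban1983to89.B1TorusBoxHolderLetters

open Literature.MathematicalPhysics.QuantumFieldTheory.Balaban1983to89.HiggsLattice
open Literature.MathematicalPhysics.QuantumFieldTheory.Balaban1983to89.HiggsCovariance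
open Literature.MathematicalPhysics.QuantumFieldTheory.Balaban1983to89.HiggsCovariancePos (shift_unshift unshift_shift)
open Literature.MathematicalPhysics.QuantumFieldTheory.Balaban1983to89.B1TorusCubeCover
open Literature.MathematicalPhysics.QuantumFieldTheory.Balaban1983to89.B1TorusCubeLocality26 (rS cubeVec near_rS_of_hTor_ne_zero
  near_rS_of_hTor_shift_ne_zero four_rS_le)
open Literature.MathematicalPhysics.QuantumFieldTheory.Balaban1983to89.B1TorusCubeChart
open Literature.MathematicalPhysics.QuantumFieldTheory.Balaban1983to89.B1TorusCubeContours (one_le_n)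
open Literature.MathematicalPhysics.QuantumFieldTheory.Balaban1983to89.B1TorusCubeBoxOp (hTor_toT two_le_half)
open Literature.MathematicalPhysics.QuantumFieldTheory.Balaban1983to89.B4GaugeCovariance (pathEnd)
open Literature.MathematicalPhysics.QuantumFieldTheory.Balaban1983to89.B4Lemma22HolderBox (pathSum IsNNChain)
open Literature.MathematicalPhysics.QuantumFieldTheory.Balaban1983to89.B4Lemma22ReduceZero (Box)
open Literature.MathematicalPhysics.QuantumFieldTheory.Balaban1983to89.B4PartitionUnity22 (hprof D1 D2 D1_nonneg D2_nonneg
  contDiff_hprof hasCompactSupport_hprof)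
open Literature.MathematicalPhysics.QuantumFieldTheory.Balaban1983to89.B2Restr216Lattice (norm_U_apply)
open Literature.MathematicalPhysics.QuantumFieldTheory.Balaban1983to89.B1TorusCubeDeriv (covDeriv_hsmul covDeriv_congr_bond
  abs_hTor_shift_sub_le abs_sderiv_hTor_le)
open Literature.MathematicalPhysics.QuantumFieldTheory.Balaban1983to89.B1TorusChainTransport
open Literature.MathematicalPhysics.QuantumFieldTheory.Balaban1983to89.B1TorusChainChart
open Literature.MathematicalPhysics.QuantumFieldTheory.Balaban1983to89.B1TorusCubeHolderProbe (norm_probe_hsmul_le abs_hTor_chain_sub_le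
  abs_sderiv_hTor_sub_le)
open Literature.MathematicalPhysics.QuantumFieldTheory.Balaban1983to89.B1TorusRegionCubes
open Literature.MathematicalPhysics.QuantumFieldTheory.Balaban1983to89.B1TorusSubBoxChart (boxT mem_boxT_iff)
open Literature.MathematicalPhysics.QuantumFieldTheory.Balaban1983to89.B1TorusSubBoxOp (subbox_inputs)
open Literature.MathematicalPhysics.QuantumFieldTheory.Balaban1983to89.B1TorusSubBoxHolderInput (subbox_input_holder)
open Literature.MathematicalPhysics.QuantumFieldTheory.Balaban1983to89.B1Ineq225DerivRegularRegion (cube_deriv_sup covDeriv_zero')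
open Literature.MathematicalPhysics.QuantumFieldTheory.Balaban1983to89.B1Ineq224RegularRegion (cube_input_holder_reg_on)
open Literature.MathematicalPhysics.QuantumFieldTheory.Balaban1983to89.B1Ineq225RegularRegion (Gloc_of_good bOp_of_good
  abs_acT_sub_le_of_reg_on)
open Literature.MathematicalPhysics.QuantumFieldTheory.Balaban1983to89.B1Ineq225DecayBackgroundTorus (tdist_le_of_near eight_rS_le)
open Literature.MathematicalPhysics.QuantumFieldTheory.Balaban1983to89.B1Ineq225RegularBox

variable {P : HiggsLattice.Params} {N : ℕ}

/-! ## §1 The (1,α)-quotient of one letter `h_ju` with the inputs at the field `A` itself -/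

section Probe

variable {K K₀ : ℕ}

/-- the end point of a chain is one of its sites. [folklore] -/
private theorem pathEnd_mem' {k : ℕ} (x : HiggsLattice.Site P k) (l : List (HiggsLattice.Site P k)) : pathEnd x l ∈ x :: l := by
  induction l generalizing x with
  | nil => simp [pathEnd]
  | cons y l ih => exact List.mem_cons_of_mem _ (ih y)

set_option maxHeartbeats 800000 in
/-- **THE HÖLDER QUOTIENT OF `D^ε_A(h_ju)` BETWEEN TWO NEARBY BONDS, INPUTS AT THE RAW FIELD** (gen 10's `norm_probe_hsmul_le` for the boundary
pieces «Ã_j = A»): `K ≤ K_P`, `K₀ ∣ M_P`, `K₀ ≥ 8`, `3M ≤ |T_ε|_μ`, room `4(rS + d·L^K + 2) ≤ 3M`; ANY `A`; a set `R` of sites; sites `x ≠ x′`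
with `|x − x′| ≤ L^K` joined by a nearest-neighbour chain `Γ` of length `≤ d|x − x′|` such that the sites of `Γ` (and `x + εe_μ`, `x′ + εe_μ`)
that lie in `□_j` lie in `R`; a field `u` with `‖u‖_∞ ≤ γ₀`, `‖D^ε_Au(b)‖ ≤ γ_D` on the bonds of `R`, and the Hölder input
`‖U(A(Γ))D^ε_Au(⟨x′,μ⟩) − D^ε_Au(⟨x,μ⟩)‖ ≤ γ_H` (asked only when `x, x + εe_μ, x′, x′ + εe_μ` and `Γ` lie in `R`).  Then
`‖U(A(Γ))D^ε_A(h_ju)(⟨x′,μ⟩) − D^ε_A(h_ju)(⟨x,μ⟩)‖ ≤ γ_H + δ₁·(2|Γ| + 2)·n⁻¹·γ_D + δ₂·d|Γ|·(n²ε)⁻¹·γ₀`, `δ₁ = d(D₁+D₂)/K₀`, `δ₂ = (D₁² + D₂)/K₀²`,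
`n = L^K` — Leibniz at both bonds, the four terms of the product rule, as in gen 10 (no change of field).
[cite: Balaban1983RegularityDecay, Theorem (1.9) p.573; (2.13) p.577; (2.18)–(2.20) p.578; §2 p.575 «Ã_j = A», p.577 «|∂^ηh_j| ≤ O(M⁻¹), |Δ^ηh_j| ≤ O(M⁻²)»]
[cite: Balaban1982Higgs1, Prop. 2.1 (2.24) p.610, p.611 l.1–2] -/
theorem norm_probe_hsmul_le_on (C : ChargeData N) (hK : K ≤ P.K) (hK₀ : K₀ ∣ P.M) (hK₀8 : 8 ≤ K₀)
    (hN3 : ∀ μ, 3 * half P K K₀ ≤ P.sitesPerDir 0 μ) (hroom : 4 * (rS P K K₀ + P.d * P.L ^ K + 2) ≤ 3 * half P K K₀)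
    (j : Lab P K K₀) (R : Finset (HiggsLattice.Site P 0)) (A : HiggsLattice.VecField P 0) (u : HiggsLattice.ScalarField P 0 N)
    {γ0 γD γH : ℝ} (hγ0 : 0 ≤ γ0) (hγD : 0 ≤ γD) (hγH : 0 ≤ γH) (μ : Fin P.d) {x x' : HiggsLattice.Site P 0}
    {l : List (HiggsLattice.Site P 0)} (hch : IsTChain x l) (hend : pathEnd x l = x')
    (hlen : (l.length : ℝ) ≤ (P.d : ℝ) * HiggsLattice.Site.tdist x x') (hnear : HiggsLattice.Site.tdist x x' ≤ P.L ^ K)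
    (hR : ∀ y ∈ x :: l, y ∈ cube K K₀ j → y ∈ R) (hRμ : x.shift μ ∈ cube K K₀ j → x.shift μ ∈ R)
    (hRμ' : x'.shift μ ∈ cube K K₀ j → x'.shift μ ∈ R)
    (hu : ∀ y, ‖u y‖ ≤ γ0)
    (hDu : ∀ (y : HiggsLattice.Site P 0) (ν : Fin P.d), y ∈ R → y.shift ν ∈ R → ‖covDeriv C A u ⟨y, ν⟩‖ ≤ γD)
    (hH : x ∈ R → x.shift μ ∈ R → x' ∈ R → x'.shift μ ∈ R → (∀ y ∈ l, y ∈ R) →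
      ‖hol C A x l (covDeriv C A u ⟨x', μ⟩) - covDeriv C A u ⟨x, μ⟩‖ ≤ γH) :
    ‖hol C A x l (covDeriv C A (hTor K K₀ j • u) ⟨x', μ⟩) - covDeriv C A (hTor K K₀ j • u) ⟨x, μ⟩‖
      ≤ γH + ((dd P : ℝ) + 1) * (D1 hprof + D2 hprof) / K₀ * ((2 * l.length + 2) / (((P.L - 1 + 1) ^ K : ℕ) : ℝ)) * γD
          + (D1 hprof ^ 2 + D2 hprof) / (K₀ : ℝ) ^ 2 * ((P.d : ℝ) * l.length / ((((P.L - 1 + 1) ^ K : ℕ) : ℝ) ^ 2 * P.mesh 0)) * γ0 := by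
  have hK₀' : 1 ≤ K₀ := le_trans (by norm_num) hK₀8
  have hh2 : 2 ≤ half P K K₀ := two_le_half hK₀8
  have hS3 : ∀ μ', 2 < P.sitesPerDir 0 μ' := fun μ' => by
    have := hN3 μ'; have : 1 ≤ half P K K₀ := le_trans (by norm_num) hh2; omega
  have hD1 := D1_nonneg contDiff_hprof hasCompactSupport_hprof
  have hD2 := D2_nonneg contDiff_hprof hasCompactSupport_hprof
  have hn : (0 : ℝ) < (((P.L - 1 + 1) ^ K : ℕ) : ℝ) := by exact_mod_cast one_le_n P K
  have hε : 0 < P.mesh 0 := P.mesh_pos 0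
  have hmeshK : 0 < P.mesh K := P.mesh_pos K
  have hK₀r : (0 : ℝ) < K₀ := by exact_mod_cast hK₀'
  have hrhs : 0 ≤ γH + ((dd P : ℝ) + 1) * (D1 hprof + D2 hprof) / K₀ * ((2 * l.length + 2) / (((P.L - 1 + 1) ^ K : ℕ) : ℝ)) * γD
      + (D1 hprof ^ 2 + D2 hprof) / (K₀ : ℝ) ^ 2 * ((P.d : ℝ) * l.length / ((((P.L - 1 + 1) ^ K : ℕ) : ℝ) ^ 2 * P.mesh 0)) * γ0 := by
    positivity
  -- the length of the contour in lattice units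
  have hlenN : l.length ≤ P.d * P.L ^ K := by
    have h1 : (l.length : ℝ) ≤ (P.d : ℝ) * (P.L ^ K : ℕ) := hlen.trans (mul_le_mul_of_nonneg_left (by exact_mod_cast hnear) (Nat.cast_nonneg _))
    exact_mod_cast h1
  by_cases hzero : hTor K K₀ j x = 0 ∧ hTor K K₀ j (x.shift μ) = 0 ∧ hTor K K₀ j x' = 0 ∧ hTor K K₀ j (x'.shift μ) = 0
  · -- both derivatives vanish
    obtain ⟨h0, h1, h2, h3⟩ := hzero
    have hv : ∀ (y : HiggsLattice.Site P 0), hTor K K₀ j y = 0 → hTor K K₀ j (y.shift μ) = 0 → covDeriv C A (hTor K K₀ j • u) ⟨y, μ⟩ = 0 := by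
      intro y hy hys
      rw [covDeriv_hsmul, hy, zero_smul, zero_add]
      unfold sderiv
      rw [show (HiggsLattice.PBond.tgt ⟨y, μ⟩ : HiggsLattice.Site P 0) = y.shift μ from rfl, hys, hy, sub_zero, smul_zero, zero_smul]
    rw [hv x h0 h1, hv x' h2 h3, map_zero, sub_zero, norm_zero]
    exact hrhs
  · -- `x` or `x′` is within `rS` of `Mj`; the whole contour within `rS + |Γ|`
    have hnear1 : Near K K₀ (rS P K K₀) j x ∨ Near K K₀ (rS P K K₀) j x' := by
      by_contra hc
      push Not at hc
      apply hzero
      refine ⟨?_, ?_, ?_, ?_⟩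
      · by_contra h; exact hc.1 (near_rS_of_hTor_ne_zero hK hK₀ hK₀8 h)
      · by_contra h; exact hc.1 (near_rS_of_hTor_shift_ne_zero hK hK₀ hK₀8 h)
      · by_contra h; exact hc.2 (near_rS_of_hTor_ne_zero hK hK₀ hK₀8 h)
      · by_contra h; exact hc.2 (near_rS_of_hTor_shift_ne_zero hK hK₀ hK₀8 h)
    set r₁ : ℕ := rS P K K₀ + P.d * P.L ^ K with hr₁
    have hall : ∀ y ∈ x :: l, Near K K₀ r₁ j y := by
      intro y hy
      rcases hnear1 with h | h
      · exact near_mono (by rw [hr₁]; omega) (near_chain_fwd hch h y hy)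
      · rw [← hend] at h
        exact near_mono (by rw [hr₁]; omega) (near_chain_bwd hch h y hy)
    have hr₁2 : r₁ + 2 < half P K K₀ := by rw [hr₁]; omega
    have hcube : ∀ y ∈ x :: l, ∀ ν, y ∈ cube K K₀ j ∧ y.shift ν ∈ cube K K₀ j ∧ (y.shift ν).shift μ ∈ cube K K₀ j := by
      intro y hy ν
      have h0 := hall y hy
      refine ⟨mem_cube.mpr (inCube_of_near (by omega) h0), mem_cube.mpr (inCube_of_near (by omega) (near_shift h0 ν)),
        mem_cube.mpr (inCube_of_near (by omega) (near_shift (near_shift h0 ν) μ))⟩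
    have hx : x ∈ x :: l := by simp
    have hx' : x' ∈ x :: l := by rw [← hend]; exact pathEnd_mem' x l
    -- Leibniz at both bonds and the four terms
    set W := hol C A x l with hW
    set D' := covDeriv C A u ⟨x', μ⟩ with hD'
    set D := covDeriv C A u ⟨x, μ⟩ with hD
    set s' := sderiv (hTor K K₀ j) ⟨x', μ⟩ with hs'
    set s := sderiv (hTor K K₀ j) ⟨x, μ⟩ with hs
    set v' := u (x'.shift μ) with hv'
    set v := u (x.shift μ) with hv
    have hLx' : covDeriv C A (hTor K K₀ j • u) ⟨x', μ⟩ = hTor K K₀ j x' • D' + s' • C.U (P.mesh 0) (A ⟨x', μ⟩) v' :=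
      covDeriv_hsmul C A (hTor K K₀ j) u ⟨x', μ⟩
    have hLx : covDeriv C A (hTor K K₀ j • u) ⟨x, μ⟩ = hTor K K₀ j x • D + s • C.U (P.mesh 0) (A ⟨x, μ⟩) v :=
      covDeriv_hsmul C A (hTor K K₀ j) u ⟨x, μ⟩
    have hsplit : W (covDeriv C A (hTor K K₀ j • u) ⟨x', μ⟩) - covDeriv C A (hTor K K₀ j • u) ⟨x, μ⟩
        = hTor K K₀ j x' • (W D' - D) + (hTor K K₀ j x' - hTor K K₀ j x) • D
          + s' • (W (C.U (P.mesh 0) (A ⟨x', μ⟩) v') - C.U (P.mesh 0) (A ⟨x, μ⟩) v)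
          + (s' - s) • C.U (P.mesh 0) (A ⟨x, μ⟩) v := by
      rw [hLx', hLx, map_add, map_smul, map_smul]
      module
    rw [hsplit]
    -- sizes of the four terms
    have hxc : x ∈ cube K K₀ j := (hcube x hx μ).1
    have hxs : x.shift μ ∈ cube K K₀ j := (hcube x hx μ).2.1
    have hx'c : x' ∈ cube K K₀ j := (hcube x' hx' μ).1
    have hx's : x'.shift μ ∈ cube K K₀ j := (hcube x' hx' μ).2.1
    have hxR : x ∈ R := hR x hx hxc
    have hxsR : x.shift μ ∈ R := hRμ hxs
    have hx'R : x' ∈ R := hR x' hx' hx'c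
    have hx'sR : x'.shift μ ∈ R := hRμ' hx's
    have hlR : ∀ y ∈ x :: l, y ∈ R := fun y hy => hR y hy (hcube y hy μ).1
    have hDn : ‖D‖ ≤ γD := hDu x μ hxR hxsR
    have hD'n : ‖D'‖ ≤ γD := hDu x' μ hx'R hx'sR
    have hHn : ‖W D' - D‖ ≤ γH := hH hxR hxsR hx'R hx'sR (fun y hy => hlR y (List.mem_cons_of_mem _ hy))
    have hh1 : |hTor K K₀ j x'| ≤ 1 := abs_hTor_le_one hK hK₀ hK₀' j x'
    have hhd : |hTor K K₀ j x' - hTor K K₀ j x| ≤ l.length * (((dd P : ℝ) + 1) * (D1 hprof + D2 hprof) / K₀ / (((P.L - 1 + 1) ^ K : ℕ) : ℝ)) := by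
      rw [← hend]; exact abs_hTor_chain_sub_le hK hK₀ hK₀8 hN3 j hch
    have hs'n : |s'| ≤ ((dd P : ℝ) + 1) * (D1 hprof + D2 hprof) / K₀ * (P.mesh K)⁻¹ := abs_sderiv_hTor_le hK hK₀ hK₀8 hN3 j ⟨x', μ⟩
    have hsd : |s' - s| ≤ (D1 hprof ^ 2 + D2 hprof) * ((P.d : ℝ) * l.length) / ((((P.L - 1 + 1) ^ K : ℕ) : ℝ) ^ 2 * (K₀ : ℝ) ^ 2) * (P.mesh 0)⁻¹ :=
      abs_sderiv_hTor_sub_le hK hK₀ hK₀8 hN3 j μ hch hend (fun y hy => (hcube y hy μ).1) hxs hx's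
    -- the transported bracket: `W(U_{b′}u(b′₊)) − U_bu(b₊) = W(εD′) + (W u(x′) − u(x)) − εD`
    have hbr : W (C.U (P.mesh 0) (A ⟨x', μ⟩) v') - C.U (P.mesh 0) (A ⟨x, μ⟩) v
        = W (P.mesh 0 • D') + (W (u x') - u x) - P.mesh 0 • D := by
      have e1 : C.U (P.mesh 0) (A ⟨x', μ⟩) v' = u x' + P.mesh 0 • D' :=
        sub_eq_iff_eq_add'.mp (U_apply_sub_eq_smul_covDeriv C A u ⟨x', μ⟩)
      have e2 : C.U (P.mesh 0) (A ⟨x, μ⟩) v = u x + P.mesh 0 • D :=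
        sub_eq_iff_eq_add'.mp (U_apply_sub_eq_smul_covDeriv C A u ⟨x, μ⟩)
      rw [e1, e2, map_add]; abel
    have hWu : ‖W (u x') - u x‖ ≤ P.mesh 0 * l.length * γD := by
      rw [hW, ← hend]
      exact norm_hol_apply_sub_le hS3 C A u R hDu hch hlR
    have hbrn : ‖W (C.U (P.mesh 0) (A ⟨x', μ⟩) v') - C.U (P.mesh 0) (A ⟨x, μ⟩) v‖ ≤ P.mesh 0 * (l.length + 2) * γD := by
      rw [hbr]
      calc ‖W (P.mesh 0 • D') + (W (u x') - u x) - P.mesh 0 • D‖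
          ≤ ‖W (P.mesh 0 • D') + (W (u x') - u x)‖ + ‖P.mesh 0 • D‖ := norm_sub_le _ _
        _ ≤ ‖W (P.mesh 0 • D')‖ + ‖W (u x') - u x‖ + ‖P.mesh 0 • D‖ := add_le_add (norm_add_le _ _) le_rfl
        _ ≤ P.mesh 0 * γD + P.mesh 0 * l.length * γD + P.mesh 0 * γD := by
            refine add_le_add (add_le_add ?_ hWu) ?_
            · rw [hW, norm_hol_apply, norm_smul, Real.norm_eq_abs, abs_of_pos hε]
              exact mul_le_mul_of_nonneg_left hD'n hε.le
            · rw [norm_smul, Real.norm_eq_abs, abs_of_pos hε]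
              exact mul_le_mul_of_nonneg_left hDn hε.le
        _ = P.mesh 0 * (l.length + 2) * γD := by ring
    -- mesh relations: `L^Kε = n·ε`
    have hmesh : P.mesh K = (((P.L - 1 + 1) ^ K : ℕ) : ℝ) * P.mesh 0 := by
      rw [predL_succ]; unfold HiggsLattice.Params.mesh; push_cast; ring
    -- assemble
    calc ‖hTor K K₀ j x' • (W D' - D) + (hTor K K₀ j x' - hTor K K₀ j x) • D
          + s' • (W (C.U (P.mesh 0) (A ⟨x', μ⟩) v') - C.U (P.mesh 0) (A ⟨x, μ⟩) v) + (s' - s) • C.U (P.mesh 0) (A ⟨x, μ⟩) v‖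
        ≤ ‖hTor K K₀ j x' • (W D' - D)‖ + ‖(hTor K K₀ j x' - hTor K K₀ j x) • D‖
          + ‖s' • (W (C.U (P.mesh 0) (A ⟨x', μ⟩) v') - C.U (P.mesh 0) (A ⟨x, μ⟩) v)‖ + ‖(s' - s) • C.U (P.mesh 0) (A ⟨x, μ⟩) v‖ := by
          refine (norm_add_le _ _).trans (add_le_add ((norm_add_le _ _).trans (add_le_add (norm_add_le _ _) le_rfl)) le_rfl)
      _ ≤ 1 * γH + l.length * (((dd P : ℝ) + 1) * (D1 hprof + D2 hprof) / K₀ / (((P.L - 1 + 1) ^ K : ℕ) : ℝ)) * γD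
          + ((dd P : ℝ) + 1) * (D1 hprof + D2 hprof) / K₀ * (P.mesh K)⁻¹ * (P.mesh 0 * (l.length + 2) * γD)
          + (D1 hprof ^ 2 + D2 hprof) * ((P.d : ℝ) * l.length) / ((((P.L - 1 + 1) ^ K : ℕ) : ℝ) ^ 2 * (K₀ : ℝ) ^ 2) * (P.mesh 0)⁻¹ * γ0 := by
          simp only [norm_smul, Real.norm_eq_abs]
          refine add_le_add (add_le_add (add_le_add ?_ ?_) ?_) ?_
          · exact mul_le_mul hh1 hHn (norm_nonneg _) zero_le_one
          · exact mul_le_mul hhd hDn (norm_nonneg _) (by positivity)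
          · exact mul_le_mul hs'n hbrn (norm_nonneg _) (by positivity)
          · rw [norm_U_apply]
            exact mul_le_mul hsd (hu _) (norm_nonneg _) (by positivity)
      _ = γH + ((dd P : ℝ) + 1) * (D1 hprof + D2 hprof) / K₀ * ((2 * l.length + 2) / (((P.L - 1 + 1) ^ K : ℕ) : ℝ)) * γD
          + (D1 hprof ^ 2 + D2 hprof) / (K₀ : ℝ) ^ 2 * ((P.d : ℝ) * l.length / ((((P.L - 1 + 1) ^ K : ℕ) : ℝ) ^ 2 * P.mesh 0)) * γ0 := by
          rw [hmesh]
          field_simp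
          ring

end Probe

/-! ## §2 The Hölder letter at EVERY label of a cell-product box under (2.23) on the box -/

section Letters

variable {K K₀ : ℕ}

/-- the near-regime bookkeeping (gen 12's `gammaT_le`): `γ_T ≤ C_near·(t/n)^α·(L^Kε)` for `1 ≤ t ≤ n`, `|Γ| ≤ dt`, `K₀ ≥ 8`. [folklore] -/
private theorem gammaT_le' {Pd K₀ : ℕ} (hK₀8 : 8 ≤ K₀) {D₁ D₂ CH Cδ Cγ t n m0 ℓ α : ℝ} (hD₁ : 0 ≤ D₁) (hD₂ : 0 ≤ D₂)
    (hCδ : 0 ≤ Cδ) (hCγ : 0 ≤ Cγ) (hn : 0 < n) (hm0 : 0 < m0) (ht1 : 1 ≤ t) (htn : t ≤ n) (hℓ0 : 0 ≤ ℓ)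
    (hℓ : ℓ ≤ (Pd : ℝ) * t) (hα1 : α < 1) :
    CH * (t / n) ^ α * (n * m0) + (Pd : ℝ) * (D₁ + D₂) / (K₀ : ℝ) * ((2 * ℓ + 2) / n) * (Cδ * (n * m0))
        + (D₁ ^ 2 + D₂) / (K₀ : ℝ) ^ 2 * ((Pd : ℝ) * ℓ / (n ^ 2 * m0)) * (Cγ * (n * m0) ^ 2)
      ≤ (CH + (Pd : ℝ) * (D₁ + D₂) / 8 * (2 * (Pd : ℝ) + 2) * Cδ + (D₁ ^ 2 + D₂) / 64 * (Pd : ℝ) ^ 2 * Cγ) * (t / n) ^ α * (n * m0) := by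
  have hK₀r : (8 : ℝ) ≤ K₀ := by exact_mod_cast hK₀8
  have ht0 : 0 < t := lt_of_lt_of_le one_pos ht1
  have hq0 : 0 < t / n := div_pos ht0 hn
  have hq1 : t / n ≤ 1 := (div_le_one hn).2 htn
  set w : ℝ := (t / n) ^ α with hw
  have hqw : t / n ≤ w := by
    have h := Real.rpow_le_rpow_of_exponent_ge hq0 hq1 hα1.le
    rwa [Real.rpow_one] at h
  have hw0 : 0 ≤ w := Real.rpow_nonneg hq0.le α
  have hPd : (0 : ℝ) ≤ Pd := Nat.cast_nonneg _
  have h2b : (2 * ℓ + 2) / n ≤ (2 * (Pd : ℝ) + 2) * w := by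
    have h1 : 2 * ℓ + 2 ≤ (2 * (Pd : ℝ) + 2) * t := by nlinarith
    calc (2 * ℓ + 2) / n ≤ (2 * (Pd : ℝ) + 2) * t / n := div_le_div_of_nonneg_right h1 hn.le
      _ = (2 * (Pd : ℝ) + 2) * (t / n) := by ring
      _ ≤ (2 * (Pd : ℝ) + 2) * w := mul_le_mul_of_nonneg_left hqw (by positivity)
  have h2a : (Pd : ℝ) * (D₁ + D₂) / (K₀ : ℝ) ≤ (Pd : ℝ) * (D₁ + D₂) / 8 :=
    div_le_div_of_nonneg_left (by positivity) (by norm_num) hK₀r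
  have h2 : (Pd : ℝ) * (D₁ + D₂) / (K₀ : ℝ) * ((2 * ℓ + 2) / n) * (Cδ * (n * m0))
      ≤ (Pd : ℝ) * (D₁ + D₂) / 8 * ((2 * (Pd : ℝ) + 2) * w) * (Cδ * (n * m0)) := by
    have h2c : 0 ≤ (2 * ℓ + 2) / n := by positivity
    gcongr
  have h3a : (D₁ ^ 2 + D₂) / (K₀ : ℝ) ^ 2 ≤ (D₁ ^ 2 + D₂) / 64 :=
    div_le_div_of_nonneg_left (by positivity) (by norm_num) (by nlinarith)
  have h3e : (D₁ ^ 2 + D₂) / (K₀ : ℝ) ^ 2 * ((Pd : ℝ) * ℓ / (n ^ 2 * m0)) * (Cγ * (n * m0) ^ 2)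
      = (D₁ ^ 2 + D₂) / (K₀ : ℝ) ^ 2 * ((Pd : ℝ) * ℓ) * (Cγ * m0) := by
    field_simp
  have h3b : (Pd : ℝ) * ℓ ≤ (Pd : ℝ) ^ 2 * w * n := by
    calc (Pd : ℝ) * ℓ ≤ (Pd : ℝ) * ((Pd : ℝ) * t) := mul_le_mul_of_nonneg_left hℓ hPd
      _ = (Pd : ℝ) ^ 2 * (t / n) * n := by field_simp
      _ ≤ (Pd : ℝ) ^ 2 * w * n := by gcongr
  have h3 : (D₁ ^ 2 + D₂) / (K₀ : ℝ) ^ 2 * ((Pd : ℝ) * ℓ / (n ^ 2 * m0)) * (Cγ * (n * m0) ^ 2)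
      ≤ (D₁ ^ 2 + D₂) / 64 * ((Pd : ℝ) ^ 2 * w * n) * (Cγ * m0) := by
    rw [h3e]
    have : 0 ≤ (Pd : ℝ) * ℓ := by positivity
    gcongr
  calc CH * (t / n) ^ α * (n * m0) + (Pd : ℝ) * (D₁ + D₂) / (K₀ : ℝ) * ((2 * ℓ + 2) / n) * (Cδ * (n * m0))
        + (D₁ ^ 2 + D₂) / (K₀ : ℝ) ^ 2 * ((Pd : ℝ) * ℓ / (n ^ 2 * m0)) * (Cγ * (n * m0) ^ 2)
      ≤ CH * w * (n * m0) + (Pd : ℝ) * (D₁ + D₂) / 8 * ((2 * (Pd : ℝ) + 2) * w) * (Cδ * (n * m0))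
        + (D₁ ^ 2 + D₂) / 64 * ((Pd : ℝ) ^ 2 * w * n) * (Cγ * m0) := by rw [hw]; linarith
    _ = (CH + (Pd : ℝ) * (D₁ + D₂) / 8 * (2 * (Pd : ℝ) + 2) * Cδ + (D₁ ^ 2 + D₂) / 64 * (Pd : ℝ) ^ 2 * Cγ) * w * (n * m0) := by
        ring

/-- `‖h_j·ψ‖_∞ ≤ ‖ψ‖_∞` (`0 ≤ h_j ≤ 1`). [cite: Balaban1983RegularityDecay, §2 p.575 «0 ≤ h_j ≤ 1»] -/
private theorem norm_hTor_smul_le (hK : K ≤ P.K) (hK₀ : K₀ ∣ P.M) (hK₀' : 1 ≤ K₀) (j : Lab P K K₀) (ψ : HiggsLattice.ScalarField P 0 N) :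
    ‖hTor K K₀ j • ψ‖ ≤ ‖ψ‖ := by
  refine (pi_norm_le_iff_of_nonneg (norm_nonneg _)).2 fun y => ?_
  rw [Pi.smul_apply', norm_smul, Real.norm_eq_abs]
  calc |hTor K K₀ j y| * ‖ψ y‖ ≤ 1 * ‖ψ y‖ := mul_le_mul_of_nonneg_right (abs_hTor_le_one hK hK₀ hK₀' j y) (norm_nonneg _)
    _ = ‖ψ y‖ := one_mul _
    _ ≤ ‖ψ‖ := norm_le_pi_norm ψ y

set_option maxHeartbeats 1600000 in
/-- **THE HÖLDER LETTER AT EVERY LABEL OF A CELL-PRODUCT BOX `Ω = cellBox S`, UNDER (2.23) ON `Ω`** («all □_j in the representation (2.13) are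
cubes and we can apply Lemma 2.2 to all operators in it»).  For `d0, ℓ0`, `a > 0`, `m² > 0`, `m²₊`, `c ≥ 0`, `β > 0` and `0 ≤ α < 1`: a constant
`C_T > 0` and, for every `K₀ ≥ 8(d0+1) + 24`, a threshold `e₁ > 0` such that for every torus of the carrier (`dd P = d0`, `L − 1 = ℓ0`),
`1 ≤ K ≤ K_P`, `K₀ ∣ M_P`, `3M ≤ |T_ε|_μ`, `m²(L^Kε)² ≤ m²₊`, every `S`, `A`, `0 < e_K ≤ e₁` with (2.23) on `Ω`, every direction `μ`, sites
`x ≠ x′` with `x, x + εe_μ, x′, x′ + εe_μ ∈ Ω` and `|x − x′| ≤ L^K`, every nearest-neighbour chain `Γ ⊂ Ω` from `x` to `x′` with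
`|Γ| ≤ d|x − x′|`, EVERY label `j` and every `Ω`-supported `ψ`:
`‖U(A(Γ))(D^ε_A a_jψ)(⟨x′,μ⟩) − (D^ε_A a_jψ)(⟨x,μ⟩)‖ ≤ C_T·(|x − x′|/L^K)^α·(L^Kε)·‖ψ‖_∞`, `a_jψ = h_jG_j(h_jψ)`.  At an interior window
(`□_j ⊆ Ω`) this is gen 10's `norm_probe_hsmul_le` fed by gen 12's `cube_deriv_sup` and `cube_input_holder_reg_on` in the window's own gauge
«Ã_j = A₀ + θ_jA′»; at a boundary piece — a sub-box of the neighbouring chart (`piece_cellBox_eq_boxT`) — it is `norm_probe_hsmul_le_on` fed by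
`B1TorusSubBoxOp.subbox_inputs` and `B1TorusSubBoxHolderInput.subbox_input_holder` at the raw field «Ã_j = A»; an empty piece contributes
nothing.
[cite: Balaban1983RegularityDecay, §2 p.575, Lemma 2.2 (2.16)–(2.17) pp.577–578, (2.20) p.578, p.579 L25–28, (1.9) p.573]
[cite: Balaban1982Higgs1, Prop. 2.1 (2.23)–(2.24) p.610, p.611 l.1–2] -/
theorem box_letters_holder (C : ChargeData N) (d0 ℓ0 : ℕ) (hℓ0 : 1 ≤ ℓ0) {a : ℝ} (ha : 0 < a) {msq : ℝ} (hmsq : 0 < msq) (m2plus : ℝ)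
    (creg β : ℝ) (hcreg : 0 ≤ creg) (hβ : 0 < β) {α : ℝ} (hα0 : 0 ≤ α) (hα1 : α < 1) :
    ∃ CT : ℝ, 0 < CT ∧ ∀ K₀ : ℕ, 8 * (d0 + 1) + 24 ≤ K₀ → ∃ e₁ : ℝ, 0 < e₁ ∧
      ∀ (P : HiggsLattice.Params), dd P = d0 → P.L - 1 = ℓ0 → ∀ {K : ℕ}, 1 ≤ K → K ≤ P.K → K₀ ∣ P.M →
      (∀ μ, 3 * half P K K₀ ≤ P.sitesPerDir 0 μ) → msq * P.mesh K ^ 2 ≤ m2plus →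
      ∀ (S : Fin P.d → Finset ℕ) (A : HiggsLattice.VecField P 0) {ec : ℝ}, 0 < ec → ec ≤ e₁ →
      (∀ z ∈ cellBox K K₀ S, ∀ μ ν : Fin P.d,
          P.mesh K * |C.e| / ec * |A ⟨z.shift μ, ν⟩ - A ⟨z, ν⟩| ≤ creg * ec ^ (β - 1) / (P.L : ℝ) ^ K) →
      ∀ (μ : Fin P.d) (x x' : HiggsLattice.Site P 0) (l : List (HiggsLattice.Site P 0)),
        x ∈ cellBox K K₀ S → x.shift μ ∈ cellBox K K₀ S → x' ∈ cellBox K K₀ S → x'.shift μ ∈ cellBox K K₀ S → x' ≠ x →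
        IsTChain x l → pathEnd x l = x' → (∀ y ∈ l, y ∈ cellBox K K₀ S) →
        (l.length : ℝ) ≤ (P.d : ℝ) * HiggsLattice.Site.tdist x x' → HiggsLattice.Site.tdist x x' ≤ P.L ^ K →
      ∀ (j : Lab P K K₀) (ψ : HiggsLattice.ScalarField P 0 N), (∀ y, y ∉ cellBox K K₀ S → ψ y = 0) →
        ‖hol C A x l (covDeriv C A (aOp C K K₀ (cellBox K K₀ S) A msq a j ψ) ⟨x', μ⟩)
            - covDeriv C A (aOp C K K₀ (cellBox K K₀ S) A msq a j ψ) ⟨x, μ⟩‖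
          ≤ CT * ((HiggsLattice.Site.tdist x x' : ℝ) / (P.L : ℝ) ^ K) ^ α * P.mesh K * ‖ψ‖ := by
  obtain ⟨Cγ2, Cδ, CT0, hCγ2, hCδ, hCT0, hder⟩ := cube_deriv_sup C d0 ℓ0 hℓ0 ha hmsq m2plus creg β hcreg hβ
  obtain ⟨CH, hCH, hhol⟩ := cube_input_holder_reg_on C d0 ℓ0 hℓ0 ha hmsq m2plus creg β hcreg hβ hα0 hα1
  obtain ⟨Cγ', Cβ', hCγ', hCβ', hsub⟩ := subbox_inputs C d0 ℓ0 hℓ0 a a m2plus ha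
  obtain ⟨CH', hCH', hsubH⟩ := subbox_input_holder C d0 ℓ0 hℓ0 a a m2plus ha hα0 hα1
  have hD1 := D1_nonneg contDiff_hprof hasCompactSupport_hprof
  have hD2 := D2_nonneg contDiff_hprof hasCompactSupport_hprof
  set Cin : ℝ := CH + ((d0 : ℝ) + 1) * (D1 hprof + D2 hprof) / 8 * (2 * ((d0 : ℝ) + 1) + 2) * Cδ
    + (D1 hprof ^ 2 + D2 hprof) / 64 * ((d0 : ℝ) + 1) ^ 2 * Cγ2 with hCin
  set Cbd : ℝ := CH' + ((d0 : ℝ) + 1) * (D1 hprof + D2 hprof) / 8 * (2 * ((d0 : ℝ) + 1) + 2) * Cγ'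
    + (D1 hprof ^ 2 + D2 hprof) / 64 * ((d0 : ℝ) + 1) ^ 2 * Cγ' with hCbd
  have hCin0 : 0 < Cin := by positivity
  have hCbd0 : 0 < Cbd := by positivity
  refine ⟨max Cin Cbd, lt_of_lt_of_le hCin0 (le_max_left _ _), fun K₀ hK₀ => ?_⟩
  have hK₀8 : 8 ≤ K₀ := by omega
  have hK₀' : 1 ≤ K₀ := by omega
  obtain ⟨e₂, he₂, hderK⟩ := hder K₀ hK₀8
  obtain ⟨e₄, he₄, hholK⟩ := hhol K₀ hK₀8
  obtain ⟨e₃, he₃, hsubK⟩ := hsub creg β hcreg hβ K₀ hK₀8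
  obtain ⟨e₅, he₅, hsubHK⟩ := hsubH creg β hcreg hβ K₀ hK₀8
  refine ⟨min (min e₂ e₄) (min e₃ e₅), lt_min (lt_min he₂ he₄) (lt_min he₃ he₅), ?_⟩
  intro P hPd hPL K hK1 hK hK₀M hN3 hcap S A ec hec hle hreg μ x x' l hxΩ hsΩ hx'Ω hs'Ω hne hch hend hlc hlen hnt j ψ hψ
  have hec2 : ec ≤ e₂ := hle.trans ((min_le_left _ _).trans (min_le_left _ _))
  have hec4 : ec ≤ e₄ := hle.trans ((min_le_left _ _).trans (min_le_right _ _))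
  have hec3 : ec ≤ e₃ := hle.trans ((min_le_right _ _).trans (min_le_left _ _))
  have hec5 : ec ≤ e₅ := hle.trans ((min_le_right _ _).trans (min_le_right _ _))
  have hK₀r : (0 : ℝ) < K₀ := by exact_mod_cast hK₀'
  have hmesh : 0 < P.mesh K := P.mesh_pos K
  have hmesh0 : 0 < P.mesh 0 := P.mesh_pos 0
  have hψ0 : 0 ≤ ‖ψ‖ := norm_nonneg _
  have hd0 : P.d = d0 + 1 := by rw [← hPd, dd_succ]
  have hdd1 : ((dd P : ℝ) + 1) = (P.d : ℝ) := by rw [← dd_succ P]; push_cast; ring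
  have hnR : ((((P.L - 1 + 1) ^ K : ℕ)) : ℝ) = (P.L : ℝ) ^ K := by rw [predL_succ, Nat.cast_pow]
  have hn0 : (0 : ℝ) < (P.L : ℝ) ^ K := pow_pos (by exact_mod_cast P.hL) K
  have hdR : ((d0 : ℝ) + 1) = (P.d : ℝ) := by rw [hd0]; push_cast; ring
  have hmeshK : P.mesh K = (P.L : ℝ) ^ K * P.mesh 0 := by unfold HiggsLattice.Params.mesh; ring
  -- the room for the contour: `4(rS + d·L^K + 2) ≤ 3M` from `K₀ ≥ 8d + 24`
  have hroom : 4 * (rS P K K₀ + P.d * P.L ^ K + 2) ≤ 3 * half P K K₀ := by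
    have h8 := eight_rS_le (P := P) (K := K) (K₀ := K₀)
    have hn1 : 1 ≤ P.L ^ K := Nat.one_le_pow K P.L P.hL
    have hK₀d : 8 * P.d + 24 ≤ K₀ := by rw [hd0]; exact hK₀
    have hh : P.L ^ K * (8 * P.d + 24) ≤ P.L ^ K * K₀ := Nat.mul_le_mul_left _ hK₀d
    unfold half at h8 ⊢
    have e1 : P.L ^ K * (8 * P.d + 24) = 8 * (P.d * P.L ^ K) + 24 * P.L ^ K := by ring
    rw [e1] at hh
    generalize P.L ^ K * K₀ = h at h8 hh ⊢
    generalize P.d * P.L ^ K = nd at hh ⊢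
    omega
  set t : ℝ := (HiggsLattice.Site.tdist x x' : ℝ) with ht_def
  have ht1 : 1 ≤ t := by
    rw [ht_def]
    obtain ⟨ν, hν⟩ : ∃ ν, x' ν ≠ x ν := by
      by_contra hc
      push Not at hc
      exact hne (funext hc)
    unfold HiggsLattice.Site.tdist
    have h1 : 1 ≤ min (x ν - x' ν).val (x' ν - x ν).val := by
      refine le_min ?_ ?_
      · exact Nat.one_le_iff_ne_zero.2 fun h0 => hν (sub_eq_zero.1 ((ZMod.val_eq_zero _).1 h0)).symm
      · exact Nat.one_le_iff_ne_zero.2 fun h0 => hν (sub_eq_zero.1 ((ZMod.val_eq_zero _).1 h0))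
    exact_mod_cast h1.trans (Finset.le_sup (f := fun ν : Fin P.d => min (x ν - x' ν).val (x' ν - x ν).val) (Finset.mem_univ ν))
  have htn : t ≤ (P.L : ℝ) ^ K := by rw [ht_def]; exact_mod_cast hnt
  have hmax0 : 0 ≤ max Cin Cbd * (t / (P.L : ℝ) ^ K) ^ α * P.mesh K * ‖ψ‖ := by
    have : 0 ≤ max Cin Cbd := hCin0.le.trans (le_max_left _ _)
    positivity
  by_cases hj : cube K K₀ j ⊆ cellBox K K₀ S
  · -- AN INTERIOR WINDOW: gen 10's probe lemma in the window's own gauge «Ã_j = A₀ + θ_jA′»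
    have hregj : ∀ z ∈ cube K K₀ j, ∀ μ' ν : Fin P.d,
        P.mesh K * |C.e| / ec * |A ⟨z.shift μ', ν⟩ - A ⟨z, ν⟩| ≤ creg * ec ^ (β - 1) / (P.L : ℝ) ^ K :=
      fun z hz μ' ν => hreg z (hj hz) μ' ν
    have hdj := hderK P hPd hPL hK1 hK hK₀M hN3 hcap j A hec hec2 hregj
    have hhj := hholK P hPd hPL hK1 hK hK₀M hN3 hcap A hec hec4 j hregj
    rw [aOp_apply, Gloc_of_good C (cellBox K K₀ S) A msq a hj]
    have hP := norm_probe_hsmul_le C hK hK₀M hK₀8 hN3 hroom j A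
      (propagatorK C (cube K K₀ j) (cubeVec K K₀ j A) msq a K (hTor K K₀ j • ψ))
      (γ0 := Cγ2 * P.mesh K ^ 2 * ‖ψ‖) (γD := Cδ * P.mesh K * ‖ψ‖) (γH := CH * (t / (P.L : ℝ) ^ K) ^ α * P.mesh K * ‖ψ‖)
      (by positivity) (by positivity) (by positivity) μ hch hend hlen hnt
      (fun y => (norm_le_pi_norm _ y).trans (hdj.1 ψ)) (fun y ν hy hs => hdj.2.1 ψ y ν hy hs)
      (fun h1 h2 h3 h4 h5 => hhj ψ μ x x' l h1 h2 h3 h4 hne hch hend h5 hlen)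
    refine hP.trans ?_
    rw [hdd1, hnR, hmeshK]
    have hγT := gammaT_le' (Pd := P.d) (K₀ := K₀) (CH := CH) (α := α) hK₀8 hD1 hD2 hCδ.le hCγ2.le hn0 hmesh0 ht1 htn
      (Nat.cast_nonneg l.length) hlen hα1
    have e1 : CH * (t / (P.L : ℝ) ^ K) ^ α * ((P.L : ℝ) ^ K * P.mesh 0) * ‖ψ‖
        + (P.d : ℝ) * (D1 hprof + D2 hprof) / K₀ * ((2 * l.length + 2) / (P.L : ℝ) ^ K) * (Cδ * ((P.L : ℝ) ^ K * P.mesh 0) * ‖ψ‖)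
        + (D1 hprof ^ 2 + D2 hprof) / (K₀ : ℝ) ^ 2 * ((P.d : ℝ) * l.length / (((P.L : ℝ) ^ K) ^ 2 * P.mesh 0))
          * (Cγ2 * ((P.L : ℝ) ^ K * P.mesh 0) ^ 2 * ‖ψ‖)
        = (CH * (t / (P.L : ℝ) ^ K) ^ α * ((P.L : ℝ) ^ K * P.mesh 0)
          + (P.d : ℝ) * (D1 hprof + D2 hprof) / K₀ * ((2 * l.length + 2) / (P.L : ℝ) ^ K) * (Cδ * ((P.L : ℝ) ^ K * P.mesh 0))
          + (D1 hprof ^ 2 + D2 hprof) / (K₀ : ℝ) ^ 2 * ((P.d : ℝ) * l.length / (((P.L : ℝ) ^ K) ^ 2 * P.mesh 0))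
            * (Cγ2 * ((P.L : ℝ) ^ K * P.mesh 0) ^ 2)) * ‖ψ‖ := by ring
    rw [e1]
    calc _ ≤ (Cin * (t / (P.L : ℝ) ^ K) ^ α * ((P.L : ℝ) ^ K * P.mesh 0)) * ‖ψ‖ := by
          rw [hCin, hdR]; exact mul_le_mul_of_nonneg_right hγT hψ0
      _ ≤ (max Cin Cbd * (t / (P.L : ℝ) ^ K) ^ α * ((P.L : ℝ) ^ K * P.mesh 0)) * ‖ψ‖ := by
          refine mul_le_mul_of_nonneg_right (mul_le_mul_of_nonneg_right (mul_le_mul_of_nonneg_right (le_max_left _ _)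
            (Real.rpow_nonneg (by positivity) _)) (by positivity)) hψ0
      _ = _ := by ring
  · by_cases hall : ∀ ν, loCell j ν ∈ S ν ∨ hiCell j ν ∈ S ν
    · -- A BOUNDARY PIECE «Ã_j = A»: a sub-box of the neighbouring chart; the probe lemma with the inputs at `A` on `boxT`
      have hpc := piece_cellBox_eq_boxT hK hK₀M hK₀' hN3 S j hall
      have hreg' : ∀ z ∈ boxT K K₀ (jB K K₀ hK hK₀M hK₀' S j) (MbB K K₀ S j), ∀ μ' ν : Fin P.d,
          P.mesh K * |C.e| / ec * |A ⟨z.shift μ', ν⟩ - A ⟨z, ν⟩| ≤ creg * ec ^ (β - 1) / (P.L : ℝ) ^ K := by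
        intro z hz μ' ν
        rw [← hpc] at hz
        exact hreg z (piece_subset _ _ hz) μ' ν
      have h17 := abs_acT_sub_le_of_reg_on_boxT hK hK₀M hK₀8 C (jB K K₀ hK hK₀M hK₀' S j) (MbB_le S j) A hec hreg'
      have hsupp : ∀ y, y ∉ boxT K K₀ (jB K K₀ hK hK₀M hK₀' S j) (MbB K K₀ S j) → (hTor K K₀ j • ψ) y = 0 := by
        intro y hy
        rw [← hpc] at hy
        exact hTor_smul_supported_piece hK hK₀M hK₀8 (cellBox K K₀ S) j hψ y hy
      have hsj := hsubK P hPd hPL K hK1 hK hK₀M hN3 a msq le_rfl le_rfl hmsq hcap (jB K K₀ hK hK₀M hK₀' S j) (MbB K K₀ S j)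
        (one_le_MbB hK₀' S j) (MbB_le S j) (dvd_MbB S j) (hTor K K₀ j) (jlB K K₀ S j) (hTor_toT_jB hK hK₀M hK₀' S j) A ec hec
        hec3 h17 ψ hsupp
      have hsHj := hsubHK P hPd hPL K hK1 hK hK₀M hN3 a msq le_rfl le_rfl hmsq hcap (jB K K₀ hK hK₀M hK₀' S j) (MbB K K₀ S j)
        (one_le_MbB hK₀' S j) (MbB_le S j) (dvd_MbB S j) A ec hec hec5 h17 (hTor K K₀ j • ψ) μ x x' l
      have hG : Gloc C K K₀ (cellBox K K₀ S) A msq a j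
          = propagatorK C (boxT K K₀ (jB K K₀ hK hK₀M hK₀' S j) (MbB K K₀ S j)) A msq a K := by
        unfold Gloc; rw [fld_of_bad hj, hpc]
      rw [aOp_apply, hG]
      -- membership in the piece: `Ω ∩ □_j = boxT`
      have hmemB : ∀ y, y ∈ cellBox K K₀ S → y ∈ cube K K₀ j → y ∈ boxT K K₀ (jB K K₀ hK hK₀M hK₀' S j) (MbB K K₀ S j) := by
        intro y hyΩ hyc
        rw [← hpc, mem_piece]; exact ⟨hyΩ, hyc⟩
      have hxl : ∀ y ∈ x :: l, y ∈ cellBox K K₀ S := by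
        intro y hy
        rcases List.mem_cons.1 hy with h | h
        · subst h; exact hxΩ
        · exact hlc y h
      have hψ' : ‖hTor K K₀ j • ψ‖ ≤ ‖ψ‖ := norm_hTor_smul_le hK hK₀M hK₀' j ψ
      have hP := norm_probe_hsmul_le_on C hK hK₀M hK₀8 hN3 hroom j (boxT K K₀ (jB K K₀ hK hK₀M hK₀' S j) (MbB K K₀ S j)) A
        (propagatorK C (boxT K K₀ (jB K K₀ hK hK₀M hK₀' S j) (MbB K K₀ S j)) A msq a K (hTor K K₀ j • ψ))
        (γ0 := Cγ' * P.mesh K ^ 2 * ‖ψ‖) (γD := Cγ' * P.mesh K * ‖ψ‖) (γH := CH' * (t / (P.L : ℝ) ^ K) ^ α * P.mesh K * ‖ψ‖)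
        (by positivity) (by positivity) (by positivity) μ hch hend hlen hnt
        (fun y hy hyc => hmemB y (hxl y hy) hyc) (fun hc => hmemB _ hsΩ hc) (fun hc => hmemB _ hs'Ω hc)
        (fun y => (norm_le_pi_norm _ y).trans hsj.1) (fun y ν hy hs => hsj.2.1 y ν hy hs)
        (fun h1 h2 h3 h4 h5 => (hsHj h1 h2 h3 h4 hne hch hend h5 hlen).trans
          (mul_le_mul_of_nonneg_left hψ' (by positivity)))
      refine hP.trans ?_
      rw [hdd1, hnR, hmeshK]
      have hγT := gammaT_le' (Pd := P.d) (K₀ := K₀) (CH := CH') (α := α) hK₀8 hD1 hD2 hCγ'.le hCγ'.le hn0 hmesh0 ht1 htn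
        (Nat.cast_nonneg l.length) hlen hα1
      have e1 : CH' * (t / (P.L : ℝ) ^ K) ^ α * ((P.L : ℝ) ^ K * P.mesh 0) * ‖ψ‖
          + (P.d : ℝ) * (D1 hprof + D2 hprof) / K₀ * ((2 * l.length + 2) / (P.L : ℝ) ^ K) * (Cγ' * ((P.L : ℝ) ^ K * P.mesh 0) * ‖ψ‖)
          + (D1 hprof ^ 2 + D2 hprof) / (K₀ : ℝ) ^ 2 * ((P.d : ℝ) * l.length / (((P.L : ℝ) ^ K) ^ 2 * P.mesh 0))
            * (Cγ' * ((P.L : ℝ) ^ K * P.mesh 0) ^ 2 * ‖ψ‖)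
          = (CH' * (t / (P.L : ℝ) ^ K) ^ α * ((P.L : ℝ) ^ K * P.mesh 0)
            + (P.d : ℝ) * (D1 hprof + D2 hprof) / K₀ * ((2 * l.length + 2) / (P.L : ℝ) ^ K) * (Cγ' * ((P.L : ℝ) ^ K * P.mesh 0))
            + (D1 hprof ^ 2 + D2 hprof) / (K₀ : ℝ) ^ 2 * ((P.d : ℝ) * l.length / (((P.L : ℝ) ^ K) ^ 2 * P.mesh 0))
              * (Cγ' * ((P.L : ℝ) ^ K * P.mesh 0) ^ 2)) * ‖ψ‖ := by ring
      rw [e1]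
      calc _ ≤ (Cbd * (t / (P.L : ℝ) ^ K) ^ α * ((P.L : ℝ) ^ K * P.mesh 0)) * ‖ψ‖ := by
            rw [hCbd, hdR]; exact mul_le_mul_of_nonneg_right hγT hψ0
        _ ≤ (max Cin Cbd * (t / (P.L : ℝ) ^ K) ^ α * ((P.L : ℝ) ^ K * P.mesh 0)) * ‖ψ‖ := by
            refine mul_le_mul_of_nonneg_right (mul_le_mul_of_nonneg_right (mul_le_mul_of_nonneg_right (le_max_right _ _)
              (Real.rpow_nonneg (by positivity) _)) (by positivity)) hψ0
        _ = _ := by ring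
    · -- AN EMPTY PIECE: `h_jψ = 0`, the letter vanishes
      obtain ⟨ν, hν⟩ := not_forall.1 hall
      obtain ⟨hlo, hhi⟩ := not_or.1 hν
      have hempty := piece_cellBox_empty hK hK₀M hK₀' S j hlo hhi
      have h0 : hTor K K₀ j • ψ = 0 := by
        funext y
        exact hTor_smul_supported_piece hK hK₀M hK₀8 (cellBox K K₀ S) j hψ y (hempty y)
      rw [aOp_apply, h0, map_zero, smul_zero, covDeriv_zero', covDeriv_zero', map_zero, sub_zero, norm_zero]
      exact hmax0

end Letters

end Literature.MathematicalPhysics.QuantumFieldTheory.Balaban1983to89.B1TorusBoxHolderLetters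

end
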